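import Literature.AlgebraicTopology.SingularHomology.HurewiczSimplexClass
import Literature.AlgebraicTopology.Homotopy.JCollapse
import HarnessLib

/-!
# Singular simplices as elements of the relative homotopy groups `πₙ(X, A, a)`

Topic `Literature/AlgebraicTopology/SingularHomology`. E. H. Spanier, *Algebraic Topology* (1966;
Springer 1981), Ch. 7 §4, p. 391 and §5, pp. 393–397: in the proof of the (relative) Hurewicz
isomorphism theorem (Thm. 7.5.4) the elements of `πₙ(X, A, x₀)` are represented by maps
"`α : (Δⁿ, Δ̇ⁿ) → (X, A)` such that `α(v₀) = x₀`" — maps of the *point model*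
`(Δⁿ, Δ̇ⁿ, v₀) → (X, A, x₀)` — and every singular simplex
`σ : (Δⁿ, Δ̇ⁿ, (Δⁿ)⁰) → (X, A, x₀)` of the Eilenberg subcomplex `Δ(X, A, x₀)ⁿ⁻¹` gets a class
`ψ(σ) = [σ]' ∈ π'ₙ(X, A, x₀)` with "if `σ(Δⁿ) ⊂ A`, then `[σ]' = 0`" (p. 397) and "any element of
`πₙ(X, A, x₀)` can be represented by such a map `α`" (p. 393).  The absolute device is
`simplexClass` (`HurewiczSimplexClass.lean`, via the homeomorphism of pairs
`κₙ = cubeSimplexHomeo n : (Iⁿ, ∂Iⁿ) ≅ (Δⁿ, ∂Δⁿ)`); this file provides the **relative** device for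
the tree's model `πₙ(X, A, a) = RelHomotopyGroup.Pi n X A a` of maps `(Iⁿ, ∂Iⁿ, J) → (X, A, a)`
(`Homotopy/RelativeHomotopyGroups.lean`), using the collapse `D₁` of `J` to the corner `0`
(`Homotopy/JCollapse.lean`), everything PROVED (`n = m + 1 ≥ 2`):

* `cubeSimplexHomeo_zero` — `κₙ(0) = v₀`: the corner `0 ∈ J` of the cube goes to the vertex
  `v₀ = stdSimplex.vertex 0` of `Δⁿ` (the chart of `SimplexBall.toBall` sends `v₀` to the
  direction `(-1, …, -1)`), so that "`α(v₀) = a`" matches the point model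
  `JCollapse.PtLoop` (maps `(Iⁿ, ∂Iⁿ, 0) → (X, A, a)`);
* `RelSimplexMap m A a` — Spanier's maps of triples `α : (Δᵐ⁺¹, ∂Δᵐ⁺¹, v₀) → (X, A, a)`;
  `relSimplexLoop α hα = (α ∘ κ) ∘ D₁` and **`relSimplexClass α hα = ⟦(α ∘ κ) ∘ D₁⟧ ∈ π_{m+1}(X, A, a)`**
  (Spanier's `[α]`);
* homotopy invariance through maps of triples (`relSimplexClass_eq_of_homotopyWith`), the
  compression half "`σ(Δⁿ) ⊂ A ⇒ [σ] = 0`" (`relSimplexClass_eq_default_of_forall_mem`),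
  surjectivity (`relSimplexClass_surjective`: every class is `[p ∘ κ⁻¹]` for any representative
  `p`), and compatibility with the absolute classes: `j_* ⟦g⟧ = [g]` for `g : (Δⁿ, ∂Δⁿ) → (X, a)`
  (`ofAbsolute_simplexClass`);
* faces: a map `τ : Δᵐ⁺² → X` sending the `m`-skeleton into `A` and the vertices to `a` restricts
  along every coface `δᵢ` to a map of triples (`comp_stdFace_mem_relSimplexMap`), as needed for
  the homotopy addition theorem (Spanier Prop. 7.5.3) in the relative case;
* all vertices: `κₙ⁻¹` sends EVERY vertex of `Δⁿ` into `J` (`cubeSimplexHomeo_symm_vertex_mem_jBoundary`: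
  `toBall(vᵢ₊₁)` has `i`-th coordinate `1`), so that the representative `(p ∘ D₁) ∘ κ⁻¹` of a class
  `⟦p⟧` sends all vertices to `a` — every element of `πₙ(X, A, a)` is the class of a simplex of
  Spanier's `Δ(X, A, a)ⁿ⁻¹` (`exists_relSimplexClass_eq_of_vertices`; Spanier §5 p. 393: "any
  element of `πₙ(X, A, x₀)` can be represented by such a map `α`", there via path-connectedness of
  `A`, here without any hypothesis).

Related device in the tree: the horn model `SimplexCone.relGenLoopOfSimplex`
(`Homotopy/SimplexConeMap.lean`: `g(∂Δ) ⊆ A`, `g(Λ₀) = {a}`, via the cone map collapsing the top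
face) with `HornNormalize.v₀` (`Homotopy/HornNormalization.lean`) the same vertex; the comparison of
the two classes for maps constant on the horn is not made here.

## References

* E. H. Spanier, *Algebraic Topology*, Springer (1981), Ch. 7 §4 p. 391, §5 pp. 393–397.
  [Spanier1981]
* A. Hatcher, *Algebraic Topology*, CUP (2002), §4.1 p. 343 (the `(Dⁿ, Sⁿ⁻¹, s₀)` model of
  `πₙ(X, A, x₀)`). [HatcherAT2002]
-/

noncomputable section

open Set Metric Function
open scoped unitInterval Topology Topology.Homotopy
open Literature.AlgebraicTopology.Homotopy

universe u

namespace Literature.AlgebraicTopology.SingularHomology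

/-! ### The corner `0` of the cube goes to the vertex `v₀` of the simplex -/

section Vertex

open Literature.AlgebraicTopology.Homotopy.SimplexBall

variable (q : ℕ)

/-- The chart of the barycentric body sends the vertex `v₀` to the constant vector `(-c, …, -c)`.
[folklore] -/
theorem chart_vertex_zero :
    chart q (stdSimplex.vertex (S := ℝ) (0 : Fin (q + 1)) : Fin (q + 1) → ℝ) = fun _ => -c q := by
  funext i
  simp [chart]

/-- **`toBall v₀ = (-1, …, -1)`**: the radial homeomorphism `Δ^q ≅ D^q` sends the vertex `v₀` to the
corner `(-1, …, -1)` of the sup-norm ball (`q ≥ 1`). [folklore] -/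
theorem toBall_vertex_zero [NeZero q] :
    (toBall q (stdSimplex.vertex (S := ℝ) (0 : Fin (q + 1))) : Fin q → ℝ) = fun _ => -1 := by
  set x : Fin q → ℝ := fun _ => -c q with hx
  have hchart : chart q (stdSimplex.vertex (S := ℝ) (0 : Fin (q + 1)) : Fin (q + 1) → ℝ) = x :=
    chart_vertex_zero q
  -- the rescaling is a non-negative multiple of the identity on each ray
  have hresc : rescale q x = (gauge (body q) x / gauge (closedBall (0 : Fin q → ℝ) 1) x) • x := rfl
  set r : ℝ := gauge (body q) x / gauge (closedBall (0 : Fin q → ℝ) 1) x with hr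
  have hr0 : 0 ≤ r := div_nonneg (gauge_nonneg _) (gauge_nonneg _)
  -- and it lands on the unit sphere since `v₀` is a boundary point of the simplex
  have hsph : rescale q x ∈ sphere (0 : Fin q → ℝ) 1 := by
    rw [← hchart, ← toBall_coe, toBall_mem_sphere_iff]
    exact ⟨(0 : Fin q).succ, by simp⟩
  have hnorm : ‖r • x‖ = r * c q := by
    rw [norm_smul, Real.norm_eq_abs, abs_of_nonneg hr0, hx, pi_norm_const, Real.norm_eq_abs,
      abs_neg, abs_of_pos (c_pos q)]
  rw [hresc, mem_sphere_zero_iff_norm, hnorm] at hsph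
  rw [toBall_coe, hchart, hresc]
  funext i
  simp only [Pi.smul_apply, smul_eq_mul, hx]
  linarith [hsph]

/-- `κ_q⁻¹(v₀) = 0`: the inverse homeomorphism sends Spanier's base vertex to the corner `0` of the
cube (`q ≥ 1`). [folklore] -/
theorem cubeSimplexHomeo_symm_vertex_zero [NeZero q] :
    (cubeSimplexHomeo q).symm (stdSimplex.vertex (S := ℝ) (0 : Fin (q + 1))) = 0 := by
  rw [cubeSimplexHomeo_symm_apply, toBall_vertex_zero]
  funext i
  apply Subtype.ext
  simp [cubeUnstretch]

/-- **`κ_q(0) = v₀`**: the homeomorphism of pairs `(I^q, ∂I^q) ≅ (Δ^q, ∂Δ^q)` of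
`HurewiczSimplexClass.lean` sends the corner `0` of the cube (a point of `J`) to Spanier's base
vertex `v₀` (`q ≥ 1`). [cite: Spanier1981, Ch. 7 §4 p. 391] -/
theorem cubeSimplexHomeo_zero [NeZero q] :
    cubeSimplexHomeo q 0 = stdSimplex.vertex (S := ℝ) (0 : Fin (q + 1)) := by
  rw [← cubeSimplexHomeo_symm_vertex_zero q, Homeomorph.apply_symm_apply]

end Vertex

/-! ### Maps of triples `(Δⁿ, ∂Δⁿ, v₀) → (X, A, a)` and their classes -/

section RelSimplex

variable {X Y : Type u} [TopologicalSpace X] [TopologicalSpace Y] {m : ℕ} {A : Set X} {a : A}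

variable (m A a) in
/-- **Spanier's maps of triples** `α : (Δᵐ⁺¹, ∂Δᵐ⁺¹, v₀) → (X, A, a)` ("`α : (Δⁿ, Δ̇ⁿ) → (X, A)` such
that `α(v₀) = x₀`", Spanier 1981, Ch. 7 §4 p. 391; §5 p. 393). [cite: Spanier1981, Ch. 7 §4 p. 391] -/
def RelSimplexMap : Set C(StdSimplex (m + 1), X) :=
  {α | (∀ t ∈ stdBoundary (m + 1), α t ∈ A) ∧ α (stdSimplex.vertex (S := ℝ) (0 : Fin (m + 2))) = a}

/-- A map constant `= a` on the boundary is a map of triples. [folklore] -/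
theorem mem_relSimplexMap_of_boundary (g : C(StdSimplex (m + 1), X)) (hg : ∀ t ∈ stdBoundary (m + 1), g t = a) :
    g ∈ RelSimplexMap m A a :=
  ⟨fun t ht => by rw [hg t ht]; exact a.2,
    hg _ ⟨(0 : Fin (m + 1)).succ, by simp⟩⟩

/-- A map sending the boundary into `A` and every vertex to `a` is a map of triples (the simplices
of Spanier's `Δ(X, A, x₀)ⁿ⁻¹` in degree `n`). [cite: Spanier1981, Ch. 7 §5 p. 393] -/
theorem mem_relSimplexMap_of_vertices (α : C(StdSimplex (m + 1), X)) (hA : ∀ t ∈ stdBoundary (m + 1), α t ∈ A)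
    (hv : ∀ i : Fin (m + 2), α (stdSimplex.vertex (S := ℝ) i) = a) : α ∈ RelSimplexMap m A a :=
  ⟨hA, hv 0⟩

/-- `α ∘ κ` is a map of triples `(Iᵐ⁺¹, ∂Iᵐ⁺¹, 0) → (X, A, a)` (point model). [folklore] -/
theorem comp_cubeToSimplex_mem_ptLoop {α : C(StdSimplex (m + 1), X)} (hα : α ∈ RelSimplexMap m A a) :
    α.comp (cubeToSimplex (m + 1)) ∈ JCollapse.PtLoop m A a :=
  ⟨fun y hy => hα.1 _ (mapsTo_cubeSimplexHomeo_boundary hy), by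
    change α (cubeSimplexHomeo (m + 1) 0) = a
    rw [cubeSimplexHomeo_zero]; exact hα.2⟩

variable [NeZero m]

/-- **The relative loop of a map of triples**: `(α ∘ κ) ∘ D₁ : (Iᵐ⁺¹, ∂Iᵐ⁺¹, J) → (X, A, a)`
(`κ` the homeomorphism of pairs cube/simplex, `D₁` the collapse of `J` to `0 = κ⁻¹(v₀)`).
[cite: Spanier1981, Ch. 7 §4 p. 391] -/
def relSimplexLoop (α : C(StdSimplex (m + 1), X)) (hα : α ∈ RelSimplexMap m A a) : RelGenLoop (0 : Fin (m + 1)) A a :=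
  JCollapse.PtLoop.toRel (α.comp (cubeToSimplex (m + 1))) (comp_cubeToSimplex_mem_ptLoop hα)

/-- `relSimplexLoop α hα` is `α ∘ κ ∘ D₁` pointwise. [folklore] -/
@[simp]
theorem relSimplexLoop_apply (α : C(StdSimplex (m + 1), X)) (hα : α ∈ RelSimplexMap m A a) (y : Fin (m + 1) → I) :
    relSimplexLoop α hα y = α (cubeSimplexHomeo (m + 1) (JCollapse.collapse m (1, y))) := rfl

/-- **The class `[α] ∈ π_{m+1}(X, A, a)` of a map of triples** `α : (Δᵐ⁺¹, ∂Δᵐ⁺¹, v₀) → (X, A, a)`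
(Spanier 1981, Ch. 7 §5 p. 393, `[α]`; p. 397, `ψ(σ) = [σ]'`). [cite: Spanier1981, Ch. 7 §5 p. 397] -/
def relSimplexClass (α : C(StdSimplex (m + 1), X)) (hα : α ∈ RelSimplexMap m A a) :
    RelHomotopyGroup.Pi (m + 1) X A a :=
  ⟦relSimplexLoop α hα⟧

/-- `[α]` is the class of `relSimplexLoop α`. [folklore] -/
theorem relSimplexClass_eq_mk (α : C(StdSimplex (m + 1), X)) (hα : α ∈ RelSimplexMap m A a) :
    relSimplexClass α hα = (⟦relSimplexLoop α hα⟧ : RelHomotopyGroup.Pi (m + 1) X A a) := rfl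

/-- `[α]` only depends on the map `α`. [folklore] -/
theorem relSimplexClass_congr {α α' : C(StdSimplex (m + 1), X)} (h : α = α') (hα : α ∈ RelSimplexMap m A a)
    (hα' : α' ∈ RelSimplexMap m A a) : relSimplexClass α hα = relSimplexClass α' hα' := by
  subst h; rfl

/-- **Homotopy invariance**: maps of triples homotopic through maps of triples have the same class
(Spanier 1981, Ch. 7 §4: `[α]` is a homotopy class of maps of triples). [cite: Spanier1981, Ch. 7 §4 p. 391] -/
theorem relSimplexClass_eq_of_homotopyWith {α α' : C(StdSimplex (m + 1), X)} (hα : α ∈ RelSimplexMap m A a)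
    (hα' : α' ∈ RelSimplexMap m A a) (H : α.HomotopyWith α' (· ∈ RelSimplexMap m A a)) :
    relSimplexClass α hα = relSimplexClass α' hα' := by
  rw [relSimplexClass_eq_mk, relSimplexClass_eq_mk]
  apply Quotient.sound
  refine JCollapse.PtLoop.homotopic_toRel _ _
    { toHomotopy := H.toHomotopy.compContinuousMap (cubeToSimplex (m + 1))
      prop' := fun t => comp_cubeToSimplex_mem_ptLoop (H.prop' t) }

/-- **A map of triples with image in `A` has trivial class** (Spanier 1981, Ch. 7 §5 p. 397: "if
`σ(Δⁿ) ⊂ A`, then `[σ]' = 0`"). [cite: Spanier1981, Ch. 7 §5 p. 397] -/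
theorem relSimplexClass_eq_default_of_forall_mem {α : C(StdSimplex (m + 1), X)} (hα : α ∈ RelSimplexMap m A a)
    (hA : ∀ t, α t ∈ A) : relSimplexClass α hα = default := by
  rw [relSimplexClass_eq_mk]
  exact JCollapse.PtLoop.toRel_mk_eq_default _ fun _ => hA _

/-- **Every relative loop is a map of triples on the simplex**: `p ∘ κ⁻¹ : (Δᵐ⁺¹, ∂Δᵐ⁺¹, v₀) → (X, A, a)`
(`κ⁻¹(v₀) = 0 ∈ J`). [folklore] -/
theorem comp_simplexToCube_mem_relSimplexMap (p : RelGenLoop (0 : Fin (m + 1)) A a) :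
    (p : C((Fin (m + 1) → I), X)).comp (simplexToCube (m + 1)) ∈ RelSimplexMap m A a :=
  ⟨fun t ht => RelGenLoop.apply_mem_of_mem_boundary p (mapsTo_cubeSimplexHomeo_symm_stdBoundary ht), by
    change p ((cubeSimplexHomeo (m + 1)).symm (stdSimplex.vertex 0)) = a
    rw [cubeSimplexHomeo_symm_vertex_zero]
    exact RelGenLoop.apply_of_mem_jBoundary p JCollapse.zero_mem_jBoundary⟩

/-- **The class of `p ∘ κ⁻¹` is `⟦p⟧`** (through `(p ∘ κ⁻¹ ∘ κ) ∘ D₁ = p ∘ D₁ ≃ p`,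
`RelHomotopyGroup.mk_toRel_self`). [folklore] -/
theorem relSimplexClass_comp_simplexToCube (p : RelGenLoop (0 : Fin (m + 1)) A a) :
    relSimplexClass ((p : C((Fin (m + 1) → I), X)).comp (simplexToCube (m + 1)))
      (comp_simplexToCube_mem_relSimplexMap p) = (⟦p⟧ : RelHomotopyGroup.Pi (m + 1) X A a) := by
  rw [relSimplexClass_eq_mk, ← RelHomotopyGroup.mk_toRel_self p]
  apply congrArg (Quotient.mk _)
  apply JCollapse.PtLoop.toRel_congr
  ext y
  change p ((cubeSimplexHomeo (m + 1)).symm (cubeSimplexHomeo (m + 1) y)) = p y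
  rw [Homeomorph.symm_apply_apply]

/-- **Every element of `π_{m+1}(X, A, a)` is the class `[α]` of a map of triples**
`(Δᵐ⁺¹, ∂Δᵐ⁺¹, v₀) → (X, A, a)` (the point model, Spanier 1981, Ch. 7 §4 p. 391). The stronger
representability by maps sending ALL vertices to `a` (the simplices of `Δ(X, A, x₀)ⁿ⁻¹`, §5
p. 393) is `exists_relSimplexClass_eq_of_vertices` below. [cite: Spanier1981, Ch. 7 §4 p. 391] -/
theorem relSimplexClass_surjective (c : RelHomotopyGroup.Pi (m + 1) X A a) :
    ∃ (α : C(StdSimplex (m + 1), X)) (hα : α ∈ RelSimplexMap m A a), relSimplexClass α hα = c := by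
  induction c using Quotient.inductionOn with
  | h p => exact ⟨_, comp_simplexToCube_mem_relSimplexMap p, relSimplexClass_comp_simplexToCube p⟩

/-- **Compatibility with the absolute classes**: for `g : (Δᵐ⁺¹, ∂Δᵐ⁺¹) → (X, a)`,
`j_* ⟦g⟧ = [g]` in `π_{m+1}(X, A, a)`, where `⟦g⟧ = simplexClass g ∈ π_{m+1}(X, a)`
(`HurewiczSimplexClass.lean`) and `j_* = RelHomotopyGroup.ofAbsolute 0`. [folklore] -/
theorem ofAbsolute_simplexClass (g : C(StdSimplex (m + 1), X)) (hg : ∀ t ∈ stdBoundary (m + 1), g t = a) :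
    RelHomotopyGroup.ofAbsolute (0 : Fin (m + 1)) (simplexClass g hg) =
      relSimplexClass (A := A) g (mem_relSimplexMap_of_boundary g hg) := by
  rw [simplexClass, RelHomotopyGroup.ofAbsolute_mk, relSimplexClass_eq_mk,
    ← RelHomotopyGroup.mk_toRel_self (RelGenLoop.ofGenLoop 0 (simplexLoop g hg))]
  rfl

/-- **Naturality in maps of pairs**: `k_* [α] = [k ∘ α]` for `k : (X, A) → (Y, B)` (functoriality of
`πₙ(X, A, x₀)`, Spanier 1981, Ch. 7 §2). [folklore] -/
theorem map_relSimplexClass {B : Set Y} (k : C(X, Y)) (hk : Set.MapsTo k A B) (α : C(StdSimplex (m + 1), X))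
    (hα : α ∈ RelSimplexMap m A a) :
    RelHomotopyGroup.map k hk (relSimplexClass α hα) =
      relSimplexClass (a := ⟨k a, hk a.2⟩) (k.comp α)
        ⟨fun t ht => hk (hα.1 t ht), by rw [ContinuousMap.comp_apply, hα.2]⟩ := by
  rw [relSimplexClass_eq_mk, RelHomotopyGroup.map_mk, relSimplexClass_eq_mk]
  rfl

/-! ### Faces of simplices with skeleton conditions are maps of triples -/

omit [NeZero m] in
/-- The cofaces send vertices to vertices: `δⱼ(vᵢ) = v_{j.succAbove i}`. [folklore] -/
theorem stdFace_vertex (j : Fin (m + 3)) (i : Fin (m + 2)) :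
    stdFace j (stdSimplex.vertex (S := ℝ) i) = stdSimplex.vertex (S := ℝ) (j.succAbove i) := by
  rw [stdFace_apply, stdSimplex.map_vertex]

omit [NeZero m] in
/-- **Faces of an Eilenberg-type simplex are maps of triples**: if `τ : Δᵐ⁺² → X` sends the
`m`-skeleton `stdSkel (m + 2) m` into `A` and every vertex to `a`, then each face `τ ∘ δⱼ` sends
`∂Δᵐ⁺¹` into `A` and `v₀` to `a` (Spanier 1981, Ch. 7 §5 (d), p. 397: the faces `σ⁽ⁱ⁾` of
`σ : (Δⁿ⁺¹, (Δⁿ⁺¹)ⁿ⁻¹, (Δⁿ⁺¹)⁰) → (X, A, x₀)`). [cite: Spanier1981, Ch. 7 §5 p. 397] -/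
theorem comp_stdFace_mem_relSimplexMap (τ : C(StdSimplex (m + 2), X))
    (hA : ∀ t ∈ stdSkel (m + 2) m, τ t ∈ A) (hv : ∀ i : Fin (m + 3), τ (stdSimplex.vertex (S := ℝ) i) = a)
    (j : Fin (m + 3)) : τ.comp (stdFace j) ∈ RelSimplexMap m A a :=
  mem_relSimplexMap_of_vertices _
    (fun t ht => by
      change τ (stdFace j t) ∈ A
      exact hA _ (stdFace_mem_stdSkel j (stdBoundary_subset_stdSkel le_rfl ht)))
    (fun i => by
      change τ (stdFace j (stdSimplex.vertex i)) = a
      rw [stdFace_vertex, hv])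

/-! ### All vertices of the simplex correspond to points of `J` -/

omit [NeZero m] in
/-- The chart of the barycentric body sends the vertex `vᵢ₊₁` to `eᵢ - (c, …, c)`. [folklore] -/
theorem chart_vertex_succ (q : ℕ) (i : Fin q) :
    Homotopy.SimplexBall.chart q (stdSimplex.vertex (S := ℝ) i.succ : Fin (q + 1) → ℝ) =
      fun j => (if j = i then 1 else 0) - Homotopy.SimplexBall.c q := by
  funext j
  simp only [Homotopy.SimplexBall.chart, stdSimplex.vertex_coe]
  by_cases h : j = i
  · subst h; simp
  · rw [Pi.single_eq_of_ne (fun h' => h (Fin.succ_injective _ h')), if_neg h]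

omit [NeZero m] in
/-- **`toBall(vᵢ₊₁)` has `i`-th coordinate `1`**: under the radial homeomorphism `Δ^q ≅ D^q` the vertex
`vᵢ₊₁` goes to a point of the face `{wᵢ = 1}` of the sup-norm ball. [folklore] -/
theorem toBall_vertex_succ_apply (q : ℕ) (i : Fin q) :
    (Homotopy.SimplexBall.toBall q (stdSimplex.vertex (S := ℝ) i.succ) : Fin q → ℝ) i = 1 := by
  open Homotopy.SimplexBall in
  set x : Fin q → ℝ := fun j => (if j = i then 1 else 0) - c q with hx
  have hchart : chart q (stdSimplex.vertex (S := ℝ) i.succ : Fin (q + 1) → ℝ) = x := chart_vertex_succ q i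
  have hresc : rescale q x = (gauge (body q) x / gauge (closedBall (0 : Fin q → ℝ) 1) x) • x := rfl
  set r : ℝ := gauge (body q) x / gauge (closedBall (0 : Fin q → ℝ) 1) x with hr
  have hr0 : 0 ≤ r := div_nonneg (gauge_nonneg _) (gauge_nonneg _)
  have hc0 := c_pos q
  have hc1 : c q ≤ 1 / 2 := by
    have hq : (1 : ℝ) ≤ q := by
      have : 0 < q := Fin.pos i
      exact_mod_cast this
    unfold Homotopy.SimplexBall.c
    rw [div_le_div_iff₀ (by positivity) (by positivity)]
    linarith
  -- `‖x‖ ≤ 1 - c` (its `i`-th coordinate is `1 - c`, the others are `-c`)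
  have hxi : x i = 1 - c q := by simp [hx]
  have hxnorm : ‖x‖ ≤ 1 - c q := by
    refine (pi_norm_le_iff_of_nonneg (by linarith)).2 fun j => ?_
    rw [Real.norm_eq_abs, abs_le]
    by_cases h : j = i
    · subst h; rw [hxi]; constructor <;> linarith
    · have : x j = - c q := by simp [hx, h]
      rw [this]; constructor <;> linarith
  -- the rescaled point is on the unit sphere
  have hsph : rescale q x ∈ sphere (0 : Fin q → ℝ) 1 := by
    rw [← hchart, ← toBall_coe, toBall_mem_sphere_iff]
    refine ⟨0, ?_⟩
    simp
  rw [hresc, mem_sphere_zero_iff_norm, norm_smul, Real.norm_eq_abs, abs_of_nonneg hr0] at hsph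
  -- hence `r (1 - c) ≥ 1`, while the `i`-th coordinate `r (1 - c)` of a point of the ball is `≤ 1`
  have h1 : 1 ≤ r * (1 - c q) := by
    calc (1 : ℝ) = r * ‖x‖ := hsph.symm
      _ ≤ r * (1 - c q) := mul_le_mul_of_nonneg_left hxnorm hr0
  have h2 : r * (1 - c q) ≤ 1 := by
    have hmem := (toBall q (stdSimplex.vertex (S := ℝ) i.succ)).2
    rw [mem_closedBall_zero_iff, pi_norm_le_iff_of_nonneg zero_le_one] at hmem
    have h := hmem i
    rw [toBall_coe, hchart, hresc, Pi.smul_apply, smul_eq_mul, hxi, Real.norm_eq_abs, abs_le] at h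
    exact h.2
  rw [toBall_coe, hchart, hresc, Pi.smul_apply, smul_eq_mul, hxi]
  linarith

omit [NeZero m] in
/-- `κ_q⁻¹(vᵢ₊₁)` has `i`-th cube coordinate `1`. [folklore] -/
theorem cubeSimplexHomeo_symm_vertex_succ_apply (q : ℕ) (i : Fin q) :
    (cubeSimplexHomeo q).symm (stdSimplex.vertex (S := ℝ) i.succ) i = 1 := by
  rw [cubeSimplexHomeo_symm_apply]
  apply Subtype.ext
  simp [cubeUnstretch, toBall_vertex_succ_apply]

/-- **`κ⁻¹` sends every vertex of `Δᵐ⁺¹` into `J`** (`m ≥ 1`): `v₀ ↦ 0 ∈ J`, `v₁ ↦` the lid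
`{y 0 = 1}`, `vᵢ₊₁ ↦` the wall `{yᵢ = 1}` (`i ≥ 1`). [folklore] -/
theorem cubeSimplexHomeo_symm_vertex_mem_jBoundary (i : Fin (m + 2)) :
    (cubeSimplexHomeo (m + 1)).symm (stdSimplex.vertex (S := ℝ) i) ∈
      RelGenLoop.jBoundary (0 : Fin (m + 1)) := by
  refine Fin.cases ?_ (fun l => ?_) i
  · rw [cubeSimplexHomeo_symm_vertex_zero]
    exact JCollapse.zero_mem_jBoundary
  · have h1 := cubeSimplexHomeo_symm_vertex_succ_apply (m + 1) l
    rw [RelGenLoop.mem_jBoundary]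
    by_cases hl : l = 0
    · subst hl; exact Or.inl h1
    · exact Or.inr ⟨l, hl, Or.inr h1⟩

/-- **Every element of `π_{m+1}(X, A, a)` is the class of a map `(Δᵐ⁺¹, ∂Δᵐ⁺¹) → (X, A)` sending
ALL vertices to `a`** — a simplex of Spanier's `Δ(X, A, a)ᵐ` in degree `m + 1` (Spanier 1981, Ch. 7
§5 p. 393: "any element of `πₙ(X, A, x₀)` can be represented by such a map `α`"). Here without any
hypothesis on `A`: for a representative `p`, the map `(p ∘ D₁) ∘ κ⁻¹` does it, since `κ⁻¹` sends the
vertices into `J` and `D₁(J) = {0}`. [cite: Spanier1981, Ch. 7 §5 p. 393] -/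
theorem exists_relSimplexClass_eq_of_vertices (c : RelHomotopyGroup.Pi (m + 1) X A a) :
    ∃ (α : C(StdSimplex (m + 1), X)) (hA : ∀ t ∈ stdBoundary (m + 1), α t ∈ A)
      (hv : ∀ i : Fin (m + 2), α (stdSimplex.vertex (S := ℝ) i) = a),
      relSimplexClass α ⟨hA, hv 0⟩ = c := by
  induction c using Quotient.inductionOn with
  | h p =>
    refine ⟨(RelGenLoop.compCollapse p 1 : C((Fin (m + 1) → I), X)).comp (simplexToCube (m + 1)),
      (comp_simplexToCube_mem_relSimplexMap _).1, fun i => ?_, ?_⟩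
    · change p (JCollapse.collapse m (1, (cubeSimplexHomeo (m + 1)).symm (stdSimplex.vertex i))) = a
      rw [JCollapse.collapse_one_of_mem_jBoundary (cubeSimplexHomeo_symm_vertex_mem_jBoundary i)]
      exact RelGenLoop.apply_of_mem_jBoundary p JCollapse.zero_mem_jBoundary
    · rw [relSimplexClass_congr rfl _ (comp_simplexToCube_mem_relSimplexMap _),
        relSimplexClass_comp_simplexToCube, RelHomotopyGroup.mk_compCollapse]

end RelSimplex

end Literature.AlgebraicTopology.SingularHomology

end
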